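import Literature.NumberTheory.LFunctions.SchoenfeldPsiDifference
import Literature.NumberTheory.LFunctions.ZetaArgVariation
import Literature.NumberTheory.LFunctions.RiemannSiegelStirling
import HarnessLib

/-!
# Sums over the zeros of `ζ` between two heights via the counting function `N(T)`

Topic: `Literature/NumberTheory/LFunctions`. THEOREMS (everything proved). Second analytic step of
the discharge of `Literature.NumberTheory.LFunctions.schoenfeld_explicit` (Schoenfeld 1976, Thm. 10 / Cor. 1). The
differenced explicit formula (`SchoenfeldPsiDifference.lean`) bounds `ψ(x) − x` by the two finite
zero sums `sumInvNorm T = ∑_{|Im ρ| ≤ T} m(ρ)/|ρ|` and `sumInvNormSq T = ∑_{|Im ρ| ≤ T} m(ρ)/|ρ|²`.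
Below a height `T₀` these are computed from located zeros (certified data); between `T₀` and `T`
they are controlled, as in Rosser–Schoenfeld 1975 (Lemma 7, "`∑ φ(γ)` by Stieltjes integration
against `N(y)`") and Schoenfeld 1976 (Lemma 9), by partial summation against the zero counting
function `N(t)` together with explicit bounds `N⁻(t) ≤ N(t) ≤ N⁺(t)`:

* `zerosBetween T₁ T₂` — the zeros with `T₁ < Im ρ ≤ T₂` (a `Finset ℂ`; `= zetaZeroBox 0 T₂ \ zetaZeroBox 0 T₁`);
  `zetaZeroCount_sub_eq_sum`: `N(T₂) − N(T₁) = ∑_{zerosBetween} m(ρ)`.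
* `sum_zerosBetween_eq` — **partial summation**: for `f ∈ C¹[T₁, T₂]`, `0 ≤ T₁ ≤ T₂`,
  `∑_{T₁ < γ ≤ T₂} m(ρ) f(γ) = (N(T₂) − N(T₁)) f(T₂) − ∫_{T₁}^{T₂} (N(t) − N(T₁)) f'(t) dt`
  (each `f(γ) = f(T₂) − ∫_γ^{T₂} f'`, and `∑_γ m 1_{γ ≤ t} = N(t) − N(T₁)`).
* `sum_zerosBetween_le_of_count_le`, `le_sum_zerosBetween_of_le_count` — the resulting upper /
  lower bounds for decreasing `f` from pointwise bounds `N ≤ N⁺`, `N⁻ ≤ N`.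
* `tail_le_of_forall_sum_le` — under RH, `β − sumInvNormSq T ≤ 2B` whenever
  `∑_{T < Im ρ ≤ U} m(ρ)/(Im ρ)² ≤ B` for all `U ≥ T` (the tail as a supremum of finite sums).
* `sum_sdiff_zerosUpTo_eq_two_mul` — the two-sided sums of `SchoenfeldPsiDifference.lean` versus
  the one-sided ones: `∑_{T₁ < |Im ρ| ≤ T₂} g(ρ) = 2 ∑_{T₁ < Im ρ ≤ T₂} g(ρ)` for conjugation-invariant `g`
  (`m(ρ̄) = m(ρ)`, `riemannZetaZeroOrder_conj_holds`); hence `sumInvNorm_sub_le`,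
  `le_sumInvNormSq_sub` in terms of `N`.
* `zetaZeroCount_le_countUpper`, `countLower_le_zetaZeroCount` — for `t ≥ 7`,
  `N(t) = θ(t)/π + 1 + S(t)` (definition of `zetaArgS`) with `|S(t)| ≤ Σ(t)`
  (`abs_zetaArgS_le`, `Σ(t) = 3 + log(120(t+5))/log(7/6) + log(t+1)/6`) and Stirling's
  `|θ(t) − (t/2 log(t/2π) − t/2 − π/8)| ≤ 2K/t` (`abs_riemannSiegelTheta_sub_stirling_le`,
  `K = stirlingVertRate (1/4)`): `N(t) ≶ t/(2π) log(t/(2π)) − t/(2π) + 7/8 ± (2K/(πt) + Σ(t))`.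

## References

* J. B. Rosser, L. Schoenfeld, *Sharper bounds for the Chebyshev functions θ(x) and ψ(x)*, Math.
  Comp. 29 (1975), 243–269, Lemma 7. [RosserSchoenfeld1975]
* L. Schoenfeld, *Sharper bounds … II*, Math. Comp. 30 (1976), 337–360, Lemma 9 and the proof of
  Thm. 10. [Schoenfeld1976]
* E. C. Titchmarsh, *The Theory of the Riemann Zeta-Function*, 2nd ed., OUP 1986, §9.3–9.4
  (Backlund's `N(T) = θ(T)/π + 1 + S(T)`, `S(T) = O(log T)`). [Titchmarsh1986]
-/

noncomputable section

open Complex Filter Set MeasureTheory Topology intervalIntegral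
open scoped Real ComplexConjugate

namespace Literature.NumberTheory.LFunctions

namespace SchoenfeldBound

open NicolasJExplicit

/-! ### Zeros between two heights and the counting function -/

/-- The zeros of `ζ` with `T₁ < Im ρ ≤ T₂` in the closed critical strip, as a finite set of complex
numbers: `zetaZeroBox 0 T₂ \ zetaZeroBox 0 T₁`. [folklore] -/
def zerosBetween (T₁ T₂ : ℝ) : Finset ℂ :=
  ((zetaZeroBox_finite 0 T₂).subset Set.sdiff_subset : (zetaZeroBox 0 T₂ \ zetaZeroBox 0 T₁).Finite).toFinset

/-- Membership in `zerosBetween T₁ T₂` (`0 ≤ T₁`): `ζ(ρ) = 0`, `0 ≤ Re ρ ≤ 1`, `T₁ < Im ρ ≤ T₂`.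
[folklore] -/
theorem mem_zerosBetween {T₁ T₂ : ℝ} (h0 : 0 ≤ T₁) {ρ : ℂ} :
    ρ ∈ zerosBetween T₁ T₂ ↔
      riemannZeta ρ = 0 ∧ 0 ≤ ρ.re ∧ ρ.re ≤ 1 ∧ T₁ < ρ.im ∧ ρ.im ≤ T₂ := by
  simp only [zerosBetween, Set.Finite.mem_toFinset, Set.mem_sdiff, zetaZeroBox, Set.mem_setOf_eq]
  constructor
  · rintro ⟨⟨hz, h1, h2, h3, h4⟩, hn⟩
    refine ⟨hz, h1, h2, ?_, h4⟩
    by_contra hle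
    exact hn ⟨hz, h1, h2, h3, not_lt.1 hle⟩
  · rintro ⟨hz, h1, h2, h3, h4⟩
    exact ⟨⟨hz, h1, h2, h0.trans_lt h3, h4⟩, fun h ↦ absurd h.2.2.2.2 (not_le.2 h3)⟩

/-- Elements of `zerosBetween T₁ T₂` (`0 ≤ T₁`) are non-trivial zeros. [folklore] -/
theorem mem_nontrivialZeros_of_mem_zerosBetween {T₁ T₂ : ℝ} (h0 : 0 ≤ T₁) {ρ : ℂ}
    (h : ρ ∈ zerosBetween T₁ T₂) : ρ ∈ RHWave0.riemannZetaNontrivialZeros := by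
  obtain ⟨hz, -, -, h3, -⟩ := (mem_zerosBetween h0).1 h
  exact ZetaZeros.riemannZetaNontrivialZeros.mem_of_im_ne_zero hz (by linarith : ρ.im ≠ 0)

/-- `m(ρ) ≥ 0` on `zerosBetween`. [folklore] -/
theorem zeroOrder_nonneg_of_mem_zerosBetween {T₁ T₂ : ℝ} (h0 : 0 ≤ T₁) {ρ : ℂ}
    (h : ρ ∈ zerosBetween T₁ T₂) : (0 : ℝ) ≤ riemannZetaZeroOrder ρ := by
  have := ZetaZeros.riemannZetaNontrivialZeros.one_le_order (mem_nontrivialZeros_of_mem_zerosBetween h0 h)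
  exact_mod_cast (zero_le_one.trans this)

/-- `N(T)` as a finite sum of multiplicities over `zetaZeroBox 0 T`. [cite: Titchmarsh1986, §9.1] -/
theorem zetaZeroCount_eq_sum (T : ℝ) :
    (zetaZeroCount T : ℝ) = ∑ ρ ∈ (zetaZeroBox_finite 0 T).toFinset, (riemannZetaZeroOrder ρ : ℝ) := by
  have hnn : 0 ≤ ∑ ρ ∈ (zetaZeroBox_finite 0 T).toFinset, riemannZetaZeroOrder ρ :=
    Finset.sum_nonneg fun ρ hρ ↦
      riemannZetaZeroOrder_nonneg_of_mem_zetaZeroBox ((Set.Finite.mem_toFinset _).1 hρ)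
  have h : (zetaZeroCount T : ℤ) = ∑ ρ ∈ (zetaZeroBox_finite 0 T).toFinset, riemannZetaZeroOrder ρ := by
    unfold zetaZeroCount zetaZeroCountRe
    rw [finsum_mem_eq_finite_toFinset_sum _ (zetaZeroBox_finite 0 T), Int.toNat_of_nonneg hnn]
  have h' : ((zetaZeroCount T : ℤ) : ℝ) =
      ((∑ ρ ∈ (zetaZeroBox_finite 0 T).toFinset, riemannZetaZeroOrder ρ : ℤ) : ℝ) := by rw [h]
  push_cast at h'
  exact h'

/-- **`N(T₂) − N(T₁) = ∑_{T₁ < Im ρ ≤ T₂} m(ρ)`** for `0 ≤ T₁ ≤ T₂`. [cite: Titchmarsh1986, §9.1] -/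
theorem zetaZeroCount_sub_eq_sum {T₁ T₂ : ℝ} (h12 : T₁ ≤ T₂) :
    (zetaZeroCount T₂ : ℝ) - zetaZeroCount T₁ = ∑ ρ ∈ zerosBetween T₁ T₂, (riemannZetaZeroOrder ρ : ℝ) := by
  classical
  rw [zetaZeroCount_eq_sum, zetaZeroCount_eq_sum]
  have hsub : (zetaZeroBox_finite 0 T₁).toFinset ⊆ (zetaZeroBox_finite 0 T₂).toFinset := by
    intro ρ hρ
    rw [Set.Finite.mem_toFinset] at hρ ⊢
    obtain ⟨hz, h1, h2, h3, h4⟩ := hρ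
    exact ⟨hz, h1, h2, h3, h4.trans h12⟩
  have hdiff : (zetaZeroBox_finite 0 T₂).toFinset \ (zetaZeroBox_finite 0 T₁).toFinset =
      zerosBetween T₁ T₂ := by
    ext ρ
    simp only [Finset.mem_sdiff, Set.Finite.mem_toFinset, zerosBetween, Set.mem_sdiff]
  rw [← Finset.sum_sdiff hsub, hdiff]
  ring

/-- The partial counts inside `(T₁, T₂]`: for `T₁ ≤ t ≤ T₂`,
`∑_{ρ ∈ zerosBetween T₁ T₂, Im ρ ≤ t} m(ρ) = N(t) − N(T₁)`. [cite: Titchmarsh1986, §9.1] -/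
theorem sum_indicator_eq_count_sub {T₁ T₂ t : ℝ} (h0 : 0 ≤ T₁) (h1 : T₁ ≤ t) (h2 : t ≤ T₂) :
    ∑ ρ ∈ zerosBetween T₁ T₂, (riemannZetaZeroOrder ρ : ℝ) * (if ρ.im ≤ t then 1 else 0) =
      (zetaZeroCount t : ℝ) - zetaZeroCount T₁ := by
  classical
  rw [zetaZeroCount_sub_eq_sum h1]
  have hfilter : (zerosBetween T₁ T₂).filter (fun ρ ↦ ρ.im ≤ t) = zerosBetween T₁ t := by
    ext ρ
    simp only [Finset.mem_filter, mem_zerosBetween h0]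
    constructor
    · rintro ⟨⟨hz, ha, hb, hc, -⟩, ht⟩; exact ⟨hz, ha, hb, hc, ht⟩
    · rintro ⟨hz, ha, hb, hc, ht⟩; exact ⟨⟨hz, ha, hb, hc, ht.trans h2⟩, ht⟩
  rw [← hfilter, Finset.sum_filter]
  refine Finset.sum_congr rfl fun ρ _ ↦ ?_
  split_ifs <;> simp

/-! ### Partial summation against `N(t)` -/

/-- For `γ ∈ (T₁, T₂]` and `f'` continuous on `[T₁, T₂]`:
`∫_{T₁}^{T₂} 1_{γ ≤ t} f'(t) dt = ∫_γ^{T₂} f'(t) dt`. [folklore] -/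
theorem integral_indicator_mul_eq {T₁ T₂ γ : ℝ} (hγ1 : T₁ < γ) (hγ2 : γ ≤ T₂) {g : ℝ → ℝ}
    (hg : ContinuousOn g (Icc T₁ T₂)) :
    ∫ t in T₁..T₂, (if γ ≤ t then (1 : ℝ) else 0) * g t = ∫ t in γ..T₂, g t := by
  have hint : ∀ a b, T₁ ≤ a → a ≤ b → b ≤ T₂ →
      IntervalIntegrable (fun t ↦ (if γ ≤ t then (1 : ℝ) else 0) * g t) volume a b := by
    intro a b ha hab hb
    have hg' : IntegrableOn g (Ioc a b) volume :=
      (hg.integrableOn_Icc.mono_set (Icc_subset_Icc ha hb)).mono_set Ioc_subset_Icc_self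
    have heq : (fun t ↦ (if γ ≤ t then (1 : ℝ) else 0) * g t) = (Ici γ).indicator g := by
      funext t
      by_cases h : γ ≤ t
      · rw [if_pos h, one_mul, Set.indicator_of_mem (show t ∈ Ici γ from h)]
      · rw [if_neg h, zero_mul, Set.indicator_of_notMem (show t ∉ Ici γ from h)]
    rw [intervalIntegrable_iff_integrableOn_Ioc_of_le hab, heq]
    exact hg'.indicator measurableSet_Ici
  rw [← integral_add_adjacent_intervals (hint T₁ γ le_rfl hγ1.le hγ2) (hint γ T₂ hγ1.le hγ2 le_rfl)]
  have h1 : ∫ t in T₁..γ, (if γ ≤ t then (1 : ℝ) else 0) * g t = 0 := by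
    rw [integral_of_le hγ1.le, MeasureTheory.integral_Ioc_eq_integral_Ioo,
      MeasureTheory.setIntegral_congr_fun measurableSet_Ioo (g := fun _ ↦ (0 : ℝ)) fun t ht ↦ by
        simp only [if_neg (not_le.2 ht.2), zero_mul]]
    simp
  have h2 : ∫ t in γ..T₂, (if γ ≤ t then (1 : ℝ) else 0) * g t = ∫ t in γ..T₂, g t := by
    rw [integral_of_le hγ2, integral_of_le hγ2]
    exact MeasureTheory.setIntegral_congr_fun measurableSet_Ioc fun t ht ↦ by
      simp only [if_pos ht.1.le, one_mul]
  rw [h1, h2, zero_add]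

/-- **Partial summation of a zero sum against `N(t)`** (Rosser–Schoenfeld 1975, Lemma 7): for
`0 ≤ T₁ ≤ T₂`, `f` differentiable with continuous derivative `f'` on `[T₁, T₂]`,
`∑_{T₁ < Im ρ ≤ T₂} m(ρ) f(Im ρ) = (N(T₂) − N(T₁)) f(T₂) − ∫_{T₁}^{T₂} (N(t) − N(T₁)) f'(t) dt`.
[cite: RosserSchoenfeld1975, Lemma 7] -/
theorem sum_zerosBetween_eq {T₁ T₂ : ℝ} (h0 : 0 ≤ T₁) (h12 : T₁ ≤ T₂) {f f' : ℝ → ℝ}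
    (hf : ∀ t ∈ Icc T₁ T₂, HasDerivAt f (f' t) t) (hf' : ContinuousOn f' (Icc T₁ T₂)) :
    ∑ ρ ∈ zerosBetween T₁ T₂, (riemannZetaZeroOrder ρ : ℝ) * f ρ.im =
      ((zetaZeroCount T₂ : ℝ) - zetaZeroCount T₁) * f T₂ -
        ∫ t in T₁..T₂, ((zetaZeroCount t : ℝ) - zetaZeroCount T₁) * f' t := by
  classical
  -- each zero: `f γ = f T₂ - ∫_{T₁}^{T₂} 1_{γ ≤ t} f'`
  have hone : ∀ ρ ∈ zerosBetween T₁ T₂, f ρ.im =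
      f T₂ - ∫ t in T₁..T₂, (if ρ.im ≤ t then (1 : ℝ) else 0) * f' t := by
    intro ρ hρ
    obtain ⟨-, -, -, h3, h4⟩ := (mem_zerosBetween h0).1 hρ
    rw [integral_indicator_mul_eq h3 h4 hf']
    have hderiv : ∀ t ∈ uIcc ρ.im T₂, HasDerivAt f (f' t) t := fun t ht ↦ by
      rw [uIcc_of_le h4] at ht
      exact hf t ⟨h3.le.trans ht.1, ht.2⟩
    have hint : IntervalIntegrable f' volume ρ.im T₂ :=
      (hf'.mono (Icc_subset_Icc h3.le le_rfl)).intervalIntegrable_of_Icc h4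
    rw [integral_eq_sub_of_hasDerivAt hderiv hint]
    ring
  have hint : ∀ ρ ∈ zerosBetween T₁ T₂, IntervalIntegrable
      (fun t ↦ (riemannZetaZeroOrder ρ : ℝ) * ((if ρ.im ≤ t then (1 : ℝ) else 0) * f' t)) volume T₁ T₂ := by
    intro ρ hρ
    have hg' : IntegrableOn f' (Ioc T₁ T₂) volume := hf'.integrableOn_Icc.mono_set Ioc_subset_Icc_self
    have heq : (fun t ↦ (if ρ.im ≤ t then (1 : ℝ) else 0) * f' t) = (Ici ρ.im).indicator f' := by
      funext t
      by_cases h : ρ.im ≤ t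
      · rw [if_pos h, one_mul, Set.indicator_of_mem (show t ∈ Ici ρ.im from h)]
      · rw [if_neg h, zero_mul, Set.indicator_of_notMem (show t ∉ Ici ρ.im from h)]
    refine IntervalIntegrable.const_mul ?_ _
    rw [intervalIntegrable_iff_integrableOn_Ioc_of_le h12, heq]
    exact hg'.indicator measurableSet_Ici
  calc ∑ ρ ∈ zerosBetween T₁ T₂, (riemannZetaZeroOrder ρ : ℝ) * f ρ.im
      = ∑ ρ ∈ zerosBetween T₁ T₂, ((riemannZetaZeroOrder ρ : ℝ) * f T₂ -
          ∫ t in T₁..T₂, (riemannZetaZeroOrder ρ : ℝ) * ((if ρ.im ≤ t then (1 : ℝ) else 0) * f' t)) := by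
        refine Finset.sum_congr rfl fun ρ hρ ↦ ?_
        rw [hone ρ hρ, intervalIntegral.integral_const_mul]
        ring
    _ = (∑ ρ ∈ zerosBetween T₁ T₂, (riemannZetaZeroOrder ρ : ℝ)) * f T₂ -
          ∫ t in T₁..T₂, ∑ ρ ∈ zerosBetween T₁ T₂,
            (riemannZetaZeroOrder ρ : ℝ) * ((if ρ.im ≤ t then (1 : ℝ) else 0) * f' t) := by
        rw [Finset.sum_sub_distrib, Finset.sum_mul, intervalIntegral.integral_finsetSum hint]
    _ = ((zetaZeroCount T₂ : ℝ) - zetaZeroCount T₁) * f T₂ -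
          ∫ t in T₁..T₂, ((zetaZeroCount t : ℝ) - zetaZeroCount T₁) * f' t := by
        rw [← zetaZeroCount_sub_eq_sum h12]
        congr 1
        refine intervalIntegral.integral_congr fun t ht ↦ ?_
        rw [uIcc_of_le h12] at ht
        rw [← sum_indicator_eq_count_sub h0 ht.1 ht.2, Finset.sum_mul]
        refine Finset.sum_congr rfl fun ρ _ ↦ ?_
        ring

/-- `t ↦ N(t) − N(T₁)` times a continuous function is interval integrable (`N` is monotone).
[folklore] -/
theorem intervalIntegrable_count_sub_mul {T₁ a b : ℝ} {g : ℝ → ℝ} (hg : ContinuousOn g (uIcc a b)) :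
    IntervalIntegrable (fun t ↦ ((zetaZeroCount t : ℝ) - zetaZeroCount T₁) * g t) volume a b := by
  have hmono : Monotone fun t ↦ ((zetaZeroCount t : ℝ) - zetaZeroCount T₁) := by
    intro s t hst
    have := zetaZeroCount_mono hst
    simp only [sub_le_sub_iff_right, Nat.cast_le, this]
  exact (hmono.intervalIntegrable).mul_continuousOn hg

/-- **Upper bound from `N ≤ N⁺`**: for `0 ≤ T₁ ≤ T₂`, `f ∈ C¹` non-increasing (`f' ≤ 0`) with
`f(T₂) ≥ 0`, and `N(t) ≤ N⁺(t)` on `[T₁, T₂]` with `N⁺` continuous,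
`∑_{T₁ < Im ρ ≤ T₂} m(ρ) f(Im ρ) ≤ (N⁺(T₂) − N(T₁)) f(T₂) + ∫_{T₁}^{T₂} (N⁺(t) − N(T₁)) (−f'(t)) dt`.
[cite: RosserSchoenfeld1975, Lemma 7] -/
theorem sum_zerosBetween_le_of_count_le {T₁ T₂ : ℝ} (h0 : 0 ≤ T₁) (h12 : T₁ ≤ T₂) {f f' Nup : ℝ → ℝ}
    (hf : ∀ t ∈ Icc T₁ T₂, HasDerivAt f (f' t) t) (hf' : ContinuousOn f' (Icc T₁ T₂))
    (hf'0 : ∀ t ∈ Icc T₁ T₂, f' t ≤ 0) (hfT : 0 ≤ f T₂)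
    (hN : ∀ t ∈ Icc T₁ T₂, (zetaZeroCount t : ℝ) ≤ Nup t) (hNc : ContinuousOn Nup (Icc T₁ T₂)) :
    ∑ ρ ∈ zerosBetween T₁ T₂, (riemannZetaZeroOrder ρ : ℝ) * f ρ.im ≤
      (Nup T₂ - zetaZeroCount T₁) * f T₂ +
        ∫ t in T₁..T₂, (Nup t - zetaZeroCount T₁) * (-f' t) := by
  rw [sum_zerosBetween_eq h0 h12 hf hf']
  have hIcc : uIcc T₁ T₂ = Icc T₁ T₂ := uIcc_of_le h12
  have h1 : ((zetaZeroCount T₂ : ℝ) - zetaZeroCount T₁) * f T₂ ≤ (Nup T₂ - zetaZeroCount T₁) * f T₂ :=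
    mul_le_mul_of_nonneg_right (by linarith [hN T₂ ⟨h12, le_rfl⟩]) hfT
  have h2 : -∫ t in T₁..T₂, ((zetaZeroCount t : ℝ) - zetaZeroCount T₁) * f' t ≤
      ∫ t in T₁..T₂, (Nup t - zetaZeroCount T₁) * (-f' t) := by
    rw [← intervalIntegral.integral_neg]
    refine intervalIntegral.integral_mono_on h12 ?_ ?_ fun t ht ↦ ?_
    · exact (intervalIntegrable_count_sub_mul (by rw [hIcc]; exact hf')).neg
    · exact ((hNc.sub continuousOn_const).mul hf'.neg).intervalIntegrable_of_Icc h12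
    · have := hN t ht
      have := hf'0 t ht
      nlinarith
  linarith

/-- **Lower bound from `N⁻ ≤ N`**: for `0 ≤ T₁ ≤ T₂`, `f ∈ C¹` non-increasing with `f(T₂) ≥ 0`,
and `N⁻(t) ≤ N(t)` on `[T₁, T₂]` with `N⁻` continuous,
`(N⁻(T₂) − N(T₁)) f(T₂) + ∫_{T₁}^{T₂} (N⁻(t) − N(T₁)) (−f'(t)) dt ≤ ∑_{T₁ < Im ρ ≤ T₂} m(ρ) f(Im ρ)`.
[cite: RosserSchoenfeld1975, Lemma 7] -/
theorem le_sum_zerosBetween_of_le_count {T₁ T₂ : ℝ} (h0 : 0 ≤ T₁) (h12 : T₁ ≤ T₂) {f f' Nlo : ℝ → ℝ}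
    (hf : ∀ t ∈ Icc T₁ T₂, HasDerivAt f (f' t) t) (hf' : ContinuousOn f' (Icc T₁ T₂))
    (hf'0 : ∀ t ∈ Icc T₁ T₂, f' t ≤ 0) (hfT : 0 ≤ f T₂)
    (hN : ∀ t ∈ Icc T₁ T₂, Nlo t ≤ (zetaZeroCount t : ℝ)) (hNc : ContinuousOn Nlo (Icc T₁ T₂)) :
    (Nlo T₂ - zetaZeroCount T₁) * f T₂ +
        ∫ t in T₁..T₂, (Nlo t - zetaZeroCount T₁) * (-f' t) ≤
      ∑ ρ ∈ zerosBetween T₁ T₂, (riemannZetaZeroOrder ρ : ℝ) * f ρ.im := by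
  rw [sum_zerosBetween_eq h0 h12 hf hf']
  have hIcc : uIcc T₁ T₂ = Icc T₁ T₂ := uIcc_of_le h12
  have h1 : (Nlo T₂ - zetaZeroCount T₁) * f T₂ ≤ ((zetaZeroCount T₂ : ℝ) - zetaZeroCount T₁) * f T₂ :=
    mul_le_mul_of_nonneg_right (by linarith [hN T₂ ⟨h12, le_rfl⟩]) hfT
  have h2 : ∫ t in T₁..T₂, (Nlo t - zetaZeroCount T₁) * (-f' t) ≤
      -∫ t in T₁..T₂, ((zetaZeroCount t : ℝ) - zetaZeroCount T₁) * f' t := by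
    rw [← intervalIntegral.integral_neg]
    refine intervalIntegral.integral_mono_on h12 ?_ ?_ fun t ht ↦ ?_
    · exact ((hNc.sub continuousOn_const).mul hf'.neg).intervalIntegrable_of_Icc h12
    · exact (intervalIntegrable_count_sub_mul (by rw [hIcc]; exact hf')).neg
    · have := hN t ht
      have := hf'0 t ht
      nlinarith
  linarith

/-! ### Two-sided sums versus one-sided sums -/

/-- For `0 ≤ T₁` and a conjugation-invariant `g`, the two-sided sum over the zeros with
`T₁ < |Im ρ| ≤ T₂` is twice the one-sided sum over `T₁ < Im ρ ≤ T₂` (the zero set and the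
multiplicities are symmetric under `ρ ↦ ρ̄`, and no zero is real). [cite: Titchmarsh1986, §2.12] -/
theorem sum_sdiff_zerosUpTo_eq_two_mul {T₁ T₂ : ℝ} (h0 : 0 ≤ T₁) {g : ℂ → ℝ}
    (hg : ∀ z : ℂ, g (conj z) = g z) :
    ∑ ρ ∈ zerosUpTo T₂ \ zerosUpTo T₁, g ρ = 2 * ∑ ρ ∈ zerosBetween T₁ T₂, g ρ := by
  classical
  set S : Finset Zeros := zerosUpTo T₂ \ zerosUpTo T₁ with hS
  set B : Finset ℂ := zerosBetween T₁ T₂ with hB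
  set B' : Finset ℂ := B.image conj with hB'
  have hmemS : ∀ ρ : Zeros, ρ ∈ S ↔ T₁ < |(ρ : ℂ).im| ∧ |(ρ : ℂ).im| ≤ T₂ := by
    intro ρ
    simp only [hS, Finset.mem_sdiff, mem_zerosUpTo, not_le]
    tauto
  have hmemB : ∀ z : ℂ, z ∈ B ↔ z ∈ RHWave0.riemannZetaNontrivialZeros ∧ T₁ < z.im ∧ z.im ≤ T₂ := by
    intro z
    rw [hB, mem_zerosBetween h0]
    constructor
    · rintro ⟨hz, -, -, h3, h4⟩
      exact ⟨ZetaZeros.riemannZetaNontrivialZeros.mem_of_im_ne_zero hz (by linarith), h3, h4⟩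
    · rintro ⟨hz, h3, h4⟩
      exact ⟨ZetaZeros.riemannZetaNontrivialZeros.zeta_eq_zero hz, (re_pos hz).le, (re_lt_one hz).le,
        h3, h4⟩
  have hmemB' : ∀ z : ℂ, z ∈ B' ↔ z ∈ RHWave0.riemannZetaNontrivialZeros ∧ T₁ < -z.im ∧ -z.im ≤ T₂ := by
    intro z
    simp only [hB', Finset.mem_image]
    constructor
    · rintro ⟨w, hw, rfl⟩
      obtain ⟨hw0, h3, h4⟩ := (hmemB w).1 hw
      refine ⟨ZetaZeros.riemannZetaNontrivialZeros.conj_mem hw0, ?_, ?_⟩ <;> simpa using by assumption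
    · rintro ⟨hz, h3, h4⟩
      refine ⟨conj z, (hmemB _).2 ⟨ZetaZeros.riemannZetaNontrivialZeros.conj_mem hz, by simpa using h3,
        by simpa using h4⟩, by simp⟩
  -- `S.map coe = B ∪ B'`, disjointly
  have himage : S.map (Function.Embedding.subtype _) = B ∪ B' := by
    ext z
    simp only [Finset.mem_map, Function.Embedding.subtype_apply, Finset.mem_union]
    constructor
    · rintro ⟨ρ, hρ, rfl⟩
      obtain ⟨h3, h4⟩ := (hmemS ρ).1 hρ
      rcases lt_or_gt_of_ne (ZetaZeros.riemannZetaNontrivialZeros.im_ne_zero ρ.2) with hneg | hpos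
      · right
        rw [abs_of_neg hneg] at h3 h4
        exact (hmemB' _).2 ⟨ρ.2, h3, h4⟩
      · left
        rw [abs_of_pos hpos] at h3 h4
        exact (hmemB _).2 ⟨ρ.2, h3, h4⟩
    · rintro (hz | hz)
      · obtain ⟨hz0, h3, h4⟩ := (hmemB z).1 hz
        refine ⟨⟨z, hz0⟩, (hmemS _).2 ?_, rfl⟩
        have : 0 < z.im := h0.trans_lt h3
        simp only [abs_of_pos this]; exact ⟨h3, h4⟩
      · obtain ⟨hz0, h3, h4⟩ := (hmemB' z).1 hz
        refine ⟨⟨z, hz0⟩, (hmemS _).2 ?_, rfl⟩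
        have : z.im < 0 := by linarith
        simp only [abs_of_neg this]; exact ⟨h3, h4⟩
  have hdisj : Disjoint B B' := by
    rw [Finset.disjoint_left]
    intro z hz hz'
    obtain ⟨-, h3, -⟩ := (hmemB z).1 hz
    obtain ⟨-, h3', -⟩ := (hmemB' z).1 hz'
    linarith
  have hinj : Set.InjOn conj (B : Set ℂ) := fun a _ b _ h ↦ by simpa using congrArg conj h
  calc ∑ ρ ∈ S, g ρ = ∑ z ∈ S.map (Function.Embedding.subtype _), g z := by
        rw [Finset.sum_map]; rfl
    _ = ∑ z ∈ B, g z + ∑ z ∈ B', g z := by rw [himage, Finset.sum_union hdisj]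
    _ = ∑ z ∈ B, g z + ∑ z ∈ B, g (conj z) := by rw [hB', Finset.sum_image hinj]
    _ = 2 * ∑ z ∈ B, g z := by simp only [hg]; ring

/-- `zerosUpTo` is monotone in the height. [folklore] -/
theorem zerosUpTo_subset {T₁ T₂ : ℝ} (h12 : T₁ ≤ T₂) : zerosUpTo T₁ ⊆ zerosUpTo T₂ := fun _ hρ ↦
  mem_zerosUpTo.2 ((mem_zerosUpTo.1 hρ).trans h12)

/-- **`sumInvNorm T₂ − sumInvNorm T₁ ≤ 2 ∑_{T₁ < Im ρ ≤ T₂} m(ρ)/Im ρ`** for `0 ≤ T₁ ≤ T₂`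
(`|ρ| ≥ Im ρ > 0`). [cite: Schoenfeld1976, Lemma 9] -/
theorem sumInvNorm_sub_le {T₁ T₂ : ℝ} (h0 : 0 ≤ T₁) (h12 : T₁ ≤ T₂) :
    sumInvNorm T₂ - sumInvNorm T₁ ≤
      2 * ∑ ρ ∈ zerosBetween T₁ T₂, (riemannZetaZeroOrder ρ : ℝ) * (ρ.im)⁻¹ := by
  classical
  have hsub := zerosUpTo_subset h12
  have hdiff : sumInvNorm T₂ - sumInvNorm T₁ =
      ∑ ρ ∈ zerosUpTo T₂ \ zerosUpTo T₁, (riemannZetaZeroOrder (ρ : ℂ) : ℝ) / ‖(ρ : ℂ)‖ := by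
    rw [sumInvNorm, sumInvNorm, ← Finset.sum_sdiff hsub]; ring
  rw [hdiff, sum_sdiff_zerosUpTo_eq_two_mul h0 (g := fun z ↦ (riemannZetaZeroOrder z : ℝ) / ‖z‖)
    (fun z ↦ by simp only [riemannZetaZeroOrder_conj_holds z, Complex.norm_conj])]
  refine mul_le_mul_of_nonneg_left (Finset.sum_le_sum fun ρ hρ ↦ ?_) (by norm_num)
  obtain ⟨-, -, -, h3, -⟩ := (mem_zerosBetween h0).1 hρ
  have him : 0 < ρ.im := h0.trans_lt h3
  rw [div_eq_mul_inv]
  refine mul_le_mul_of_nonneg_left ?_ (zeroOrder_nonneg_of_mem_zerosBetween h0 hρ)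
  exact inv_anti₀ him ((le_abs_self _).trans (Complex.abs_im_le_norm ρ))

/-- **`2 ∑_{T₁ < Im ρ ≤ T₂} m(ρ)/(¼ + (Im ρ)²) ≤ sumInvNormSq T₂ − sumInvNormSq T₁`** for `0 ≤ T₁ ≤ T₂`
whenever the zeros with `T₁ < Im ρ ≤ T₂` lie on the critical line (indeed equality: `|ρ|² = ¼ + γ²`).
[cite: Schoenfeld1976, Lemma 9] -/
theorem le_sumInvNormSq_sub_of_re {T₁ T₂ : ℝ} (h0 : 0 ≤ T₁) (h12 : T₁ ≤ T₂)
    (hhalf : ∀ ρ ∈ zerosBetween T₁ T₂, ρ.re = 1 / 2) :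
    2 * ∑ ρ ∈ zerosBetween T₁ T₂, (riemannZetaZeroOrder ρ : ℝ) * (1 / 4 + ρ.im ^ 2)⁻¹ ≤
      sumInvNormSq T₂ - sumInvNormSq T₁ := by
  classical
  have hsub := zerosUpTo_subset h12
  have hdiff : sumInvNormSq T₂ - sumInvNormSq T₁ =
      ∑ ρ ∈ zerosUpTo T₂ \ zerosUpTo T₁, (riemannZetaZeroOrder (ρ : ℂ) : ℝ) / ‖(ρ : ℂ)‖ ^ 2 := by
    rw [sumInvNormSq, sumInvNormSq, ← Finset.sum_sdiff hsub]; ring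
  rw [hdiff, sum_sdiff_zerosUpTo_eq_two_mul h0 (g := fun z ↦ (riemannZetaZeroOrder z : ℝ) / ‖z‖ ^ 2)
    (fun z ↦ by simp only [riemannZetaZeroOrder_conj_holds z, Complex.norm_conj])]
  refine mul_le_mul_of_nonneg_left (Finset.sum_le_sum fun ρ hρ ↦ le_of_eq ?_) (by norm_num)
  have hsq : ‖ρ‖ ^ 2 = 1 / 4 + ρ.im ^ 2 := by
    rw [Complex.sq_norm, Complex.normSq_apply, hhalf ρ hρ]; ring
  rw [hsq]
  ring

/-- **`2 ∑_{T₁ < Im ρ ≤ T₂} m(ρ)/(¼ + (Im ρ)²) ≤ sumInvNormSq T₂ − sumInvNormSq T₁`** under RH, for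
`0 ≤ T₁ ≤ T₂`. [cite: Schoenfeld1976, Lemma 9] -/
theorem le_sumInvNormSq_sub (hRH : RiemannHypothesis) {T₁ T₂ : ℝ} (h0 : 0 ≤ T₁) (h12 : T₁ ≤ T₂) :
    2 * ∑ ρ ∈ zerosBetween T₁ T₂, (riemannZetaZeroOrder ρ : ℝ) * (1 / 4 + ρ.im ^ 2)⁻¹ ≤
      sumInvNormSq T₂ - sumInvNormSq T₁ :=
  le_sumInvNormSq_sub_of_re h0 h12 fun _ hρ ↦
    re_eq_half_of_RH hRH (mem_nontrivialZeros_of_mem_zerosBetween h0 hρ)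

/-- **The tail of `β` from uniform bounds between heights**: under RH, for `T ≥ 0`, if
`∑_{T < Im ρ ≤ U} m(ρ)/(Im ρ)² ≤ B` for every `U ≥ T`, then
`β − sumInvNormSq T = ∑_{|Im ρ| > T} m(ρ)/|ρ|² ≤ 2B` (every finite partial sum of the tail lies below
some height `U`; `|ρ|² ≥ (Im ρ)²`). [cite: Schoenfeld1976, Lemma 9] -/
theorem tail_le_of_forall_sum_le (hRH : RiemannHypothesis) {T B : ℝ} (h0 : 0 ≤ T)
    (h : ∀ U, T ≤ U → ∑ ρ ∈ zerosBetween T U, (riemannZetaZeroOrder ρ : ℝ) * (ρ.im ^ 2)⁻¹ ≤ B) :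
    nicolasBeta - sumInvNormSq T ≤ 2 * B := by
  classical
  refine hasSum_le_of_sum_le (hasSum_tail_of_RH hRH T) fun s ↦ ?_
  -- a height above every zero of `s`
  set U : ℝ := T + ∑ ρ ∈ s, |(ρ : ℂ).im| with hU
  have hTU : T ≤ U := by
    rw [hU]; linarith [Finset.sum_nonneg (fun ρ (_ : ρ ∈ s) ↦ abs_nonneg ((ρ : ℂ).im))]
  have hle : ∀ ρ ∈ s, |(ρ : ℂ).im| ≤ U := fun ρ hρ ↦ by
    rw [hU]
    have := Finset.single_le_sum (fun ρ' (_ : ρ' ∈ s) ↦ abs_nonneg ((ρ' : ℂ).im)) hρ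
    linarith
  -- the partial sum is dominated by the two-sided sum over `T < |Im ρ| ≤ U`
  have h1 : ∑ ρ ∈ s, (if ρ ∈ zerosUpTo T then 0 else
      (riemannZetaZeroOrder (ρ : ℂ) : ℝ) / ‖(ρ : ℂ)‖ ^ 2) ≤
      ∑ ρ ∈ zerosUpTo U \ zerosUpTo T, (riemannZetaZeroOrder (ρ : ℂ) : ℝ) / ‖(ρ : ℂ)‖ ^ 2 := by
    rw [← Finset.sum_filter_add_sum_filter_not s (fun ρ ↦ ρ ∈ zerosUpTo T)]
    rw [Finset.sum_congr rfl (fun ρ hρ ↦ if_pos (Finset.mem_filter.1 hρ).2), Finset.sum_const_zero,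
      zero_add, Finset.sum_congr rfl (fun ρ hρ ↦ if_neg (Finset.mem_filter.1 hρ).2)]
    refine Finset.sum_le_sum_of_subset_of_nonneg (fun ρ hρ ↦ ?_) fun ρ _ _ ↦
      div_nonneg (zeroOrder_nonneg' ρ) (sq_nonneg _)
    rw [Finset.mem_filter] at hρ
    exact Finset.mem_sdiff.2 ⟨mem_zerosUpTo.2 (hle ρ hρ.1), hρ.2⟩
  have h2 := sum_sdiff_zerosUpTo_eq_two_mul h0 (T₂ := U)
    (g := fun z ↦ (riemannZetaZeroOrder z : ℝ) / ‖z‖ ^ 2)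
    (fun z ↦ by simp only [riemannZetaZeroOrder_conj_holds z, Complex.norm_conj])
  have h3 : ∑ ρ ∈ zerosBetween T U, (riemannZetaZeroOrder ρ : ℝ) / ‖ρ‖ ^ 2 ≤
      ∑ ρ ∈ zerosBetween T U, (riemannZetaZeroOrder ρ : ℝ) * (ρ.im ^ 2)⁻¹ := by
    refine Finset.sum_le_sum fun ρ hρ ↦ ?_
    obtain ⟨-, -, -, h3, -⟩ := (mem_zerosBetween h0).1 hρ
    have him : 0 < ρ.im := h0.trans_lt h3
    rw [div_eq_mul_inv]
    refine mul_le_mul_of_nonneg_left (inv_anti₀ (by positivity) ?_) (zeroOrder_nonneg_of_mem_zerosBetween h0 hρ)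
    have := Complex.abs_im_le_norm ρ
    rw [abs_of_pos him] at this
    nlinarith
  have h4 := h U hTU
  linarith

/-! ### Explicit bounds for `N(t)`, `t ≥ 7` -/

/-- The tree's explicit bound for `|S(t)|`, `t ≥ 7`:
`Σ(t) = 3 + log(120(t+5))/log(7/6) + log(t+1)/6` (`abs_zetaArgS_le`). [cite: Titchmarsh1986, Thm. 9.4] -/
def argBound (t : ℝ) : ℝ := 3 + Real.log (120 * (t + 5)) / Real.log (7 / 6) + Real.log (t + 1) / 6

/-- Riemann–von Mangoldt main term `t/(2π) log(t/(2π)) − t/(2π) + 7/8`. [cite: Titchmarsh1986, Thm. 9.4] -/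
def countMain (t : ℝ) : ℝ := t / (2 * π) * Real.log (t / (2 * π)) - t / (2 * π) + 7 / 8

/-- The explicit upper bound `N⁺(t) = countMain t + 2K/(πt) + Σ(t)`, `K = stirlingVertRate (1/4)`.
[cite: Titchmarsh1986, Thm. 9.4] -/
def countUpper (t : ℝ) : ℝ := countMain t + 2 * stirlingVertRate (1 / 4) / (π * t) + argBound t

/-- The explicit lower bound `N⁻(t) = countMain t − 2K/(πt) − Σ(t)`. [cite: Titchmarsh1986, Thm. 9.4] -/
def countLower (t : ℝ) : ℝ := countMain t - 2 * stirlingVertRate (1 / 4) / (π * t) - argBound t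

/-- **`N(t) ≤ N⁺(t)` for `t ≥ 7`.** [cite: Titchmarsh1986, Thm. 9.4] -/
theorem zetaZeroCount_le_countUpper {t : ℝ} (ht : 7 ≤ t) : (zetaZeroCount t : ℝ) ≤ countUpper t := by
  have hπ := Real.pi_pos
  have hS := abs_zetaArgS_le ht
  have hθ := abs_riemannSiegelTheta_sub_stirling_le (t := t) (by linarith)
  rw [zetaZeroCount_eq_theta_add_zetaArgS]
  unfold countUpper countMain argBound
  have h1 := (abs_le.1 hS).2
  have h2 := (abs_le.1 hθ).2
  have ht0 : 0 < t := by linarith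
  have key : riemannSiegelTheta t / π ≤
      (t / 2 * Real.log (t / (2 * π)) - t / 2 - π / 8) / π + 2 * stirlingVertRate (1 / 4) / (π * t) := by
    have h3 : riemannSiegelTheta t / π ≤
        ((t / 2 * Real.log (t / (2 * π)) - t / 2 - π / 8) + 2 * stirlingVertRate (1 / 4) / t) / π :=
      div_le_div_of_nonneg_right (by linarith) hπ.le
    rw [add_div, div_div, mul_comm t π] at h3
    exact h3
  have e : (t / 2 * Real.log (t / (2 * π)) - t / 2 - π / 8) / π =
      t / (2 * π) * Real.log (t / (2 * π)) - t / (2 * π) - 1 / 8 := by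
    field_simp
  rw [e] at key
  linarith

/-- **`N⁻(t) ≤ N(t)` for `t ≥ 7`.** [cite: Titchmarsh1986, Thm. 9.4] -/
theorem countLower_le_zetaZeroCount {t : ℝ} (ht : 7 ≤ t) : countLower t ≤ (zetaZeroCount t : ℝ) := by
  have hπ := Real.pi_pos
  have hS := abs_zetaArgS_le ht
  have hθ := abs_riemannSiegelTheta_sub_stirling_le (t := t) (by linarith)
  rw [zetaZeroCount_eq_theta_add_zetaArgS]
  unfold countLower countMain argBound
  have h1 := (abs_le.1 hS).1
  have h2 := (abs_le.1 hθ).1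
  have ht0 : 0 < t := by linarith
  have key : (t / 2 * Real.log (t / (2 * π)) - t / 2 - π / 8) / π - 2 * stirlingVertRate (1 / 4) / (π * t) ≤
      riemannSiegelTheta t / π := by
    have h3 : ((t / 2 * Real.log (t / (2 * π)) - t / 2 - π / 8) - 2 * stirlingVertRate (1 / 4) / t) / π ≤
        riemannSiegelTheta t / π :=
      div_le_div_of_nonneg_right (by linarith) hπ.le
    rw [sub_div, div_div, mul_comm t π] at h3
    exact h3
  have e : (t / 2 * Real.log (t / (2 * π)) - t / 2 - π / 8) / π =
      t / (2 * π) * Real.log (t / (2 * π)) - t / (2 * π) - 1 / 8 := by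
    field_simp
  rw [e] at key
  linarith

/-- `countUpper`, `countLower` are continuous on `[a, b]` for `a > 0`. [folklore] -/
theorem continuousOn_countUpper {a b : ℝ} (ha : 0 < a) :
    ContinuousOn countUpper (Icc a b) ∧ ContinuousOn countLower (Icc a b) := by
  have key : ∀ t ∈ Icc a b, ContinuousAt countUpper t ∧ ContinuousAt countLower t := by
    intro t ht
    have ht0 : 0 < t := ha.trans_le ht.1
    have hπ := Real.pi_pos
    have h1 : t / (2 * π) ≠ 0 := by positivity
    have h2 : π * t ≠ 0 := by positivity
    have h3 : (120 : ℝ) * (t + 5) ≠ 0 := by positivity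
    have h4 : t + 1 ≠ 0 := by positivity
    have h5 : Real.log (7 / 6) ≠ 0 := (Real.log_pos (by norm_num)).ne'
    unfold countUpper countLower countMain argBound
    constructor <;> fun_prop (disch := assumption)
  exact ⟨fun t ht ↦ (key t ht).1.continuousWithinAt, fun t ht ↦ (key t ht).2.continuousWithinAt⟩

end SchoenfeldBound

end Literature.NumberTheory.LFunctions

end
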